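import Literature.Combinatorics.Enumerative.GlynnFormula
import Mathlib.LinearAlgebra.Matrix.Trace
import Mathlib.Analysis.SpecialFunctions.Pow.Real
import HarnessLib

/-!
# Hutchinson's stochastic trace estimator: unbiasedness and the single-sample variance

A. K. Saibaba, A. Alexanderian, I. C. F. Ipsen, *Randomized matrix-free trace and log-determinant
estimators*, Numer. Math. 137 (2017) 353–395 [SaibabaAlexanderianIpsen2017] (held text
paper:arxiv-1605.04893, chunks p0004 / p0007), on the Monte Carlo estimator
`trace(A) ≈ (1/N) Σ_j z_jᵀ A z_j`:

> The original algorithm, proposed by Hutchinson [Hutchinson1990], uses Rademacher random vectors and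
> produces an unbiased estimator. … (§2.3) The reliability of Monte Carlo estimators is judged by the
> variance of a single sample. This variance is `2(‖A‖_F² − Σ_{j=1}^n A_jj²)` for the Hutchinson
> estimator, and `2‖A‖_F²` for the Gaussian estimator.

This file proves both statements for ONE Rademacher sample, with the Rademacher vector realised —
as in `Literature/Combinatorics/Enumerative/GlynnFormula.lean` — by the uniform distribution on sign
patterns `s : Finset ι` (`z = signVec s`, `z_k = −1` iff `k ∈ s`, each of the `2^n` patterns with weight
`2^{−n}`):

* `sum_signVec_mul_signVec` — the second moments `Σ_s z_i z_j = 2^n δ_ij`;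
* `hutchinson_mean` — **unbiasedness**: `2^{−n} Σ_s zᵀAz = tr A` (any square real matrix);
* `sum_signVec_four` — the fourth moments `Σ_s z_i z_j z_k z_l` for `i ≠ j`, `k ≠ l`
  (`= 2^n` iff `{k, l} = {i, j}`, else `0`);
* `hutchinson_variance` — `2^{−n} Σ_s (zᵀAz − tr A)² = Σ_{i ≠ j} A_ij (A_ij + A_ji)` (any square real
  matrix), and for SYMMETRIC `A` (`hutchinson_variance_of_symm`) the printed
  **`2(Σ_{i,j} A_ij² − Σ_i A_ii²) = 2(‖A‖_F² − Σ_i A_ii²)`**.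

The pattern space and the uniform weight `2^{−n}` are the ones of
`Literature.Computability.QuantumComplexity.GurvitsEstimator.signWeight`, so the finite Chebyshev tail
`XEB.sum_weight_sum_le_sub_le_wvar` for `N` independent probes applies verbatim to `sample A`; the
`(ε, δ)` sample-size bounds of Avron–Toledo / Roosta-Khorasani–Ascher and the Gaussian estimator are not
formalised here.

## References
* [SaibabaAlexanderianIpsen2017] A. K. Saibaba, A. Alexanderian, I. C. F. Ipsen, Numer. Math. 137
  (2017) 353–395, §1 and §2.3 (arXiv:1605.04893).
* [Hutchinson1990] M. F. Hutchinson, *A stochastic estimator of the trace of the influence matrix for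
  Laplacian smoothing splines*, Commun. Statist. Simul. Comput. 19 (1990) 433–450 (the original; cited
  through the secondary source above).
-/

noncomputable section

open Finset Matrix
open scoped symmDiff

namespace Literature.Probability.Moments

namespace Hutchinson

open Literature.Combinatorics.Enumerative (signVec signVec_apply)

variable {ι : Type*} [Fintype ι] [DecidableEq ι]

/-- One sample of Hutchinson's estimator at the sign pattern `s`: `zᵀ A z = Σ_{i,j} z_i A_ij z_j` with
`z = signVec s ∈ {±1}^ι`. [cite: SaibabaAlexanderianIpsen2017, §1 (`trace(A) ≈ (1/N) Σ_j z_j^* A z_j`,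
Rademacher `z_j`)] -/
def sample (A : Matrix ι ι ℝ) (s : Finset ι) : ℝ := ∑ i, ∑ j, signVec s i * A i j * signVec s j

/-! ### Rademacher moments via the sign-flip involution -/

omit [Fintype ι] in
/-- Flipping the sign at `a` negates `z_a`. [folklore] -/
private theorem signVec_symmDiff_self (s : Finset ι) (a : ι) :
    (signVec (s ∆ {a}) a : ℝ) = -signVec s a := by
  simp only [signVec_apply, mem_symmDiff, mem_singleton]
  by_cases h : a ∈ s <;> simp [h]

omit [Fintype ι] in
/-- Flipping the sign at `a` leaves `z_b`, `b ≠ a`, unchanged. [folklore] -/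
private theorem signVec_symmDiff_of_ne (s : Finset ι) {a b : ι} (h : b ≠ a) :
    (signVec (s ∆ {a}) b : ℝ) = signVec s b := by
  simp only [signVec_apply, mem_symmDiff, mem_singleton, h]
  by_cases hb : b ∈ s <;> simp [hb]

omit [Fintype ι] in
/-- Flipping the sign at `a` twice is the identity. [folklore] -/
private theorem symmDiff_singleton_involutive (a : ι) :
    Function.Involutive (fun s : Finset ι => s ∆ {a}) := by
  intro s
  show s ∆ {a} ∆ {a} = s
  exact symmDiff_symmDiff_cancel_right _ _

/-- **Odd moments vanish**: if `g` is invariant under flipping the sign at `a`, then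
`Σ_s z_a(s) g(s) = 0`. [folklore] -/
private theorem sum_signVec_mul_eq_zero (a : ι) (g : Finset ι → ℝ) (hg : ∀ s, g (s ∆ {a}) = g s) :
    ∑ s : Finset ι, (signVec s a : ℝ) * g s = 0 := by
  set σ : Equiv.Perm (Finset ι) := (symmDiff_singleton_involutive a).toPerm _ with hσ
  have h : ∑ s : Finset ι, (signVec s a : ℝ) * g s =
      ∑ s : Finset ι, (signVec (σ s) a : ℝ) * g (σ s) := (Equiv.sum_comp σ _).symm
  have h2 : ∀ s, (signVec (σ s) a : ℝ) * g (σ s) = -((signVec s a : ℝ) * g s) := by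
    intro s
    show (signVec (s ∆ {a}) a : ℝ) * g (s ∆ {a}) = -((signVec s a : ℝ) * g s)
    rw [signVec_symmDiff_self, hg, neg_mul]
  simp only [h2, sum_neg_distrib] at h
  linarith

omit [Fintype ι] in
/-- `z_a² = 1`. [folklore] -/
private theorem signVec_mul_self (s : Finset ι) (a : ι) : (signVec s a : ℝ) * signVec s a = 1 := by
  rw [signVec_apply]
  split_ifs <;> norm_num

omit [DecidableEq ι] in
/-- The number of sign patterns is `2^n`. [folklore] -/
private theorem card_patterns : (Finset.univ : Finset (Finset ι)).card = 2 ^ Fintype.card ι := by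
  rw [Finset.card_univ, Fintype.card_finset]

/-- **Second moments**: `Σ_s z_i z_j = 2^n δ_ij`. [cite: SaibabaAlexanderianIpsen2017, §1
(Rademacher vectors: independent ±1 entries)] -/
theorem sum_signVec_mul_signVec (i j : ι) :
    ∑ s : Finset ι, (signVec s i : ℝ) * signVec s j = if i = j then (2 : ℝ) ^ Fintype.card ι else 0 := by
  by_cases hij : i = j
  · subst hij
    rw [if_pos rfl]
    simp_rw [signVec_mul_self]
    rw [Finset.sum_const, card_patterns]
    simp
  · rw [if_neg hij]
    exact sum_signVec_mul_eq_zero i (fun s => signVec s j)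
      (fun s => signVec_symmDiff_of_ne s (Ne.symm hij))

/-! ### Unbiasedness -/

/-- **Hutchinson's estimator is unbiased**: averaging one sample over the `2^n` equally likely sign
patterns gives the trace, `2^{−n} Σ_s zᵀAz = tr A`.
[cite: SaibabaAlexanderianIpsen2017, §1 (‘uses Rademacher random vectors and produces an unbiased
estimator’); Hutchinson1990] -/
theorem hutchinson_mean (A : Matrix ι ι ℝ) :
    ((2 : ℝ) ^ Fintype.card ι)⁻¹ * ∑ s : Finset ι, sample A s = A.trace := by
  have h : ∑ s : Finset ι, sample A s = (2 : ℝ) ^ Fintype.card ι * A.trace := by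
    unfold sample
    rw [Finset.sum_comm]
    simp_rw [Finset.sum_comm (s := (Finset.univ : Finset (Finset ι))),
      show ∀ (i j : ι) (s : Finset ι), (signVec s i : ℝ) * A i j * signVec s j =
        A i j * ((signVec s i : ℝ) * signVec s j) from fun i j s => by ring,
      ← Finset.mul_sum, sum_signVec_mul_signVec, mul_ite, mul_zero, Finset.sum_ite_eq, Finset.mem_univ,
      if_true, Matrix.trace, Matrix.diag_apply, Finset.mul_sum]
    exact Finset.sum_congr rfl fun i _ => mul_comm _ _
  rw [h, ← mul_assoc, inv_mul_cancel₀ (by positivity), one_mul]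

/-! ### The single-sample variance -/

/-- **Fourth moments** for `i ≠ j`, `k ≠ l`: `Σ_s z_i z_j z_k z_l = 2^n` if `{k, l} = {i, j}` and `0`
otherwise. [cite: SaibabaAlexanderianIpsen2017, §2.3 (the variance computation)] -/
theorem sum_signVec_four {i j k l : ι} (hij : i ≠ j) (hkl : k ≠ l) :
    ∑ s : Finset ι, (signVec s i : ℝ) * signVec s j * (signVec s k * signVec s l) =
      if (k = i ∧ l = j) ∨ (k = j ∧ l = i) then (2 : ℝ) ^ Fintype.card ι else 0 := by
  by_cases h1 : k = i ∧ l = j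
  · obtain ⟨rfl, rfl⟩ := h1
    rw [if_pos (Or.inl ⟨rfl, rfl⟩)]
    simp_rw [show ∀ s : Finset ι, (signVec s k : ℝ) * signVec s l * (signVec s k * signVec s l) =
      ((signVec s k : ℝ) * signVec s k) * (signVec s l * signVec s l) from fun s => by ring,
      signVec_mul_self, mul_one]
    rw [Finset.sum_const, card_patterns]
    simp
  by_cases h2 : k = j ∧ l = i
  · obtain ⟨rfl, rfl⟩ := h2
    rw [if_pos (Or.inr ⟨rfl, rfl⟩)]
    simp_rw [show ∀ s : Finset ι, (signVec s l : ℝ) * signVec s k * (signVec s k * signVec s l) =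
      ((signVec s k : ℝ) * signVec s k) * (signVec s l * signVec s l) from fun s => by ring,
      signVec_mul_self, mul_one]
    rw [Finset.sum_const, card_patterns]
    simp
  rw [if_neg (not_or.mpr ⟨h1, h2⟩)]
  -- some index occurs exactly once; flip it
  by_cases hki : k = i
  · -- then l ≠ j (else h1), l ≠ i = k; l occurs once
    subst hki
    have hlj : l ≠ j := fun h => h1 ⟨rfl, h⟩
    have hlk : l ≠ k := Ne.symm hkl
    have := sum_signVec_mul_eq_zero l (fun s => (signVec s k : ℝ) * signVec s j * signVec s k)
      (fun s => by simp only [signVec_symmDiff_of_ne s (Ne.symm hlk), signVec_symmDiff_of_ne s (Ne.symm hlj)])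
    calc ∑ s : Finset ι, (signVec s k : ℝ) * signVec s j * (signVec s k * signVec s l)
        = ∑ s : Finset ι, (signVec s l : ℝ) * ((signVec s k : ℝ) * signVec s j * signVec s k) :=
          sum_congr rfl fun s _ => by ring
      _ = 0 := this
  by_cases hkj : k = j
  · subst hkj
    have hli : l ≠ i := fun h => h2 ⟨rfl, h⟩
    have hlk : l ≠ k := Ne.symm hkl
    have := sum_signVec_mul_eq_zero l (fun s => (signVec s i : ℝ) * signVec s k * signVec s k)
      (fun s => by simp only [signVec_symmDiff_of_ne s (Ne.symm hlk), signVec_symmDiff_of_ne s (Ne.symm hli)])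
    calc ∑ s : Finset ι, (signVec s i : ℝ) * signVec s k * (signVec s k * signVec s l)
        = ∑ s : Finset ι, (signVec s l : ℝ) * ((signVec s i : ℝ) * signVec s k * signVec s k) :=
          sum_congr rfl fun s _ => by ring
      _ = 0 := this
  · -- k ∉ {i, j} and k ≠ l: k occurs once
    have := sum_signVec_mul_eq_zero k (fun s => (signVec s i : ℝ) * signVec s j * signVec s l)
      (fun s => by simp only [signVec_symmDiff_of_ne s (Ne.symm hki), signVec_symmDiff_of_ne s (Ne.symm hkj),
        signVec_symmDiff_of_ne s (Ne.symm hkl)])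
    calc ∑ s : Finset ι, (signVec s i : ℝ) * signVec s j * (signVec s k * signVec s l)
        = ∑ s : Finset ι, (signVec s k : ℝ) * ((signVec s i : ℝ) * signVec s j * signVec s l) :=
          sum_congr rfl fun s _ => by ring
      _ = 0 := this

/-- The centred sample is the off-diagonal quadratic form: `zᵀAz − tr A = Σ_{i ≠ j} z_i A_ij z_j`.
[cite: SaibabaAlexanderianIpsen2017, §2.3] -/
theorem sample_sub_trace (A : Matrix ι ι ℝ) (s : Finset ι) :
    sample A s - A.trace =
      ∑ i, ∑ j ∈ Finset.univ.filter (fun j => j ≠ i), signVec s i * A i j * signVec s j := by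
  unfold sample
  rw [Matrix.trace]
  have h : ∀ i, ∑ j, (signVec s i : ℝ) * A i j * signVec s j =
      A.diag i + ∑ j ∈ Finset.univ.filter (fun j => j ≠ i), signVec s i * A i j * signVec s j := by
    intro i
    rw [← Finset.sum_filter_add_sum_filter_not Finset.univ (fun j => j = i)]
    congr 1
    · rw [Finset.filter_eq' Finset.univ i, if_pos (Finset.mem_univ i), Finset.sum_singleton,
        Matrix.diag_apply, mul_comm (signVec s i : ℝ) (A i i), mul_assoc, signVec_mul_self, mul_one]
  simp_rw [h, Finset.sum_add_distrib]
  ring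

/-- **The single-sample variance of Hutchinson's estimator** (any square real matrix):
`2^{−n} Σ_s (zᵀAz − tr A)² = Σ_i Σ_{j ≠ i} A_ij (A_ij + A_ji)`.
[cite: SaibabaAlexanderianIpsen2017, §2.3] -/
theorem hutchinson_variance (A : Matrix ι ι ℝ) :
    ((2 : ℝ) ^ Fintype.card ι)⁻¹ * ∑ s : Finset ι, (sample A s - A.trace) ^ 2 =
      ∑ i, ∑ j ∈ Finset.univ.filter (fun j => j ≠ i), A i j * (A i j + A j i) := by
  have hN : (2 : ℝ) ^ Fintype.card ι ≠ 0 := by positivity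
  have hmemP : ∀ q : (_ : ι) × ι,
      q ∈ (Finset.univ : Finset ι).sigma (fun i => Finset.univ.filter (fun j => j ≠ i)) ↔ q.2 ≠ q.1 := by
    intro q
    simp
  -- the centred sample as one sum over ordered off-diagonal pairs
  have hoff : ∀ s : Finset ι, sample A s - A.trace =
      ∑ p ∈ (Finset.univ : Finset ι).sigma (fun i => Finset.univ.filter (fun j => j ≠ i)),
        (signVec s p.1 : ℝ) * A p.1 p.2 * signVec s p.2 := by
    intro s
    rw [sample_sub_trace, Finset.sum_sigma']
  -- pattern sum of a product of two summands (fourth moments)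
  have hpair : ∀ p ∈ (Finset.univ : Finset ι).sigma (fun i => Finset.univ.filter (fun j => j ≠ i)),
      ∀ q ∈ (Finset.univ : Finset ι).sigma (fun i => Finset.univ.filter (fun j => j ≠ i)),
      ∑ s : Finset ι, ((signVec s p.1 : ℝ) * A p.1 p.2 * signVec s p.2) *
          ((signVec s q.1 : ℝ) * A q.1 q.2 * signVec s q.2) =
        A p.1 p.2 * A q.1 q.2 *
          (if (q.1 = p.1 ∧ q.2 = p.2) ∨ (q.1 = p.2 ∧ q.2 = p.1) then (2 : ℝ) ^ Fintype.card ι else 0) := by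
    intro p hp q hq
    rw [← sum_signVec_four ((hmemP p).mp hp).symm ((hmemP q).mp hq).symm, Finset.mul_sum]
    exact Finset.sum_congr rfl fun s _ => by ring
  -- for fixed p only q = p and q = pᵀ survive
  have hq : ∀ p ∈ (Finset.univ : Finset ι).sigma (fun i => Finset.univ.filter (fun j => j ≠ i)),
      ∑ q ∈ (Finset.univ : Finset ι).sigma (fun i => Finset.univ.filter (fun j => j ≠ i)),
        A p.1 p.2 * A q.1 q.2 *
          (if (q.1 = p.1 ∧ q.2 = p.2) ∨ (q.1 = p.2 ∧ q.2 = p.1) then (2 : ℝ) ^ Fintype.card ι else 0) =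
        (2 : ℝ) ^ Fintype.card ι * (A p.1 p.2 * (A p.1 p.2 + A p.2 p.1)) := by
    intro p hp
    obtain ⟨i, j⟩ := p
    have hij : j ≠ i := (hmemP _).mp hp
    rw [← Finset.sum_filter_add_sum_filter_not
      ((Finset.univ : Finset ι).sigma (fun i => Finset.univ.filter (fun j => j ≠ i)))
      (fun q : (_ : ι) × ι => (q.1 = i ∧ q.2 = j) ∨ (q.1 = j ∧ q.2 = i))]
    have hzero : ∑ q ∈ ((Finset.univ : Finset ι).sigma (fun i => Finset.univ.filter (fun j => j ≠ i))).filter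
        (fun q : (_ : ι) × ι => ¬((q.1 = i ∧ q.2 = j) ∨ (q.1 = j ∧ q.2 = i))),
        A i j * A q.1 q.2 *
          (if (q.1 = i ∧ q.2 = j) ∨ (q.1 = j ∧ q.2 = i) then (2 : ℝ) ^ Fintype.card ι else 0) = 0 := by
      refine Finset.sum_eq_zero fun q hq' => ?_
      rw [Finset.mem_filter] at hq'
      rw [if_neg hq'.2, mul_zero]
    have hset : ((Finset.univ : Finset ι).sigma (fun i => Finset.univ.filter (fun j => j ≠ i))).filter
        (fun q : (_ : ι) × ι => (q.1 = i ∧ q.2 = j) ∨ (q.1 = j ∧ q.2 = i)) =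
        {(⟨i, j⟩ : (_ : ι) × ι), ⟨j, i⟩} := by
      ext q
      obtain ⟨k, l⟩ := q
      simp only [Finset.mem_filter, Finset.mem_sigma, Finset.mem_univ, true_and, Finset.mem_insert,
        Finset.mem_singleton, Sigma.mk.inj_iff, heq_eq_eq]
      constructor
      · rintro ⟨-, h⟩
        exact h
      · rintro (⟨rfl, rfl⟩ | ⟨rfl, rfl⟩)
        · exact ⟨hij, Or.inl ⟨rfl, rfl⟩⟩
        · exact ⟨hij.symm, Or.inr ⟨rfl, rfl⟩⟩
    have hne : (⟨i, j⟩ : (_ : ι) × ι) ≠ ⟨j, i⟩ := by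
      intro h
      rw [Sigma.mk.inj_iff] at h
      exact hij h.1.symm
    rw [hzero, add_zero, hset, Finset.sum_pair hne]
    simp only [true_or, or_true, if_true, and_self]
    ring
  have key : ∑ s : Finset ι, (sample A s - A.trace) ^ 2 =
      (2 : ℝ) ^ Fintype.card ι * ∑ i, ∑ j ∈ Finset.univ.filter (fun j => j ≠ i), A i j * (A i j + A j i) := by
    calc ∑ s : Finset ι, (sample A s - A.trace) ^ 2
        = ∑ s : Finset ι, ∑ p ∈ (Finset.univ : Finset ι).sigma (fun i => Finset.univ.filter (fun j => j ≠ i)),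
            ∑ q ∈ (Finset.univ : Finset ι).sigma (fun i => Finset.univ.filter (fun j => j ≠ i)),
              ((signVec s p.1 : ℝ) * A p.1 p.2 * signVec s p.2) *
                ((signVec s q.1 : ℝ) * A q.1 q.2 * signVec s q.2) := by
          refine Finset.sum_congr rfl fun s _ => ?_
          rw [hoff s, sq, Finset.sum_mul_sum]
      _ = ∑ p ∈ (Finset.univ : Finset ι).sigma (fun i => Finset.univ.filter (fun j => j ≠ i)),
            ∑ q ∈ (Finset.univ : Finset ι).sigma (fun i => Finset.univ.filter (fun j => j ≠ i)),
              ∑ s : Finset ι, ((signVec s p.1 : ℝ) * A p.1 p.2 * signVec s p.2) *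
                ((signVec s q.1 : ℝ) * A q.1 q.2 * signVec s q.2) := by
          rw [Finset.sum_comm]
          exact Finset.sum_congr rfl fun p _ => Finset.sum_comm
      _ = ∑ p ∈ (Finset.univ : Finset ι).sigma (fun i => Finset.univ.filter (fun j => j ≠ i)),
            ∑ q ∈ (Finset.univ : Finset ι).sigma (fun i => Finset.univ.filter (fun j => j ≠ i)),
              A p.1 p.2 * A q.1 q.2 *
                (if (q.1 = p.1 ∧ q.2 = p.2) ∨ (q.1 = p.2 ∧ q.2 = p.1) then (2 : ℝ) ^ Fintype.card ι
                  else 0) :=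
          Finset.sum_congr rfl fun p hp => Finset.sum_congr rfl fun q hq' => hpair p hp q hq'
      _ = ∑ p ∈ (Finset.univ : Finset ι).sigma (fun i => Finset.univ.filter (fun j => j ≠ i)),
            (2 : ℝ) ^ Fintype.card ι * (A p.1 p.2 * (A p.1 p.2 + A p.2 p.1)) :=
          Finset.sum_congr rfl hq
      _ = (2 : ℝ) ^ Fintype.card ι *
            ∑ i, ∑ j ∈ Finset.univ.filter (fun j => j ≠ i), A i j * (A i j + A j i) := by
          rw [← Finset.mul_sum, Finset.sum_sigma']
  rw [key, ← mul_assoc, inv_mul_cancel₀ hN, one_mul]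

omit [DecidableEq ι] in
/-- For a symmetric matrix the off-diagonal sum is `2(Σ_{i,j} A_ij² − Σ_i A_ii²) = 2(‖A‖_F² − Σ_i A_ii²)`.
[cite: SaibabaAlexanderianIpsen2017, §2.3] -/
theorem offDiag_sum_of_symm [DecidableEq ι] (A : Matrix ι ι ℝ) (hA : A.IsSymm) :
    ∑ i, ∑ j ∈ Finset.univ.filter (fun j => j ≠ i), A i j * (A i j + A j i) =
      2 * (∑ i, ∑ j, A i j ^ 2 - ∑ i, A i i ^ 2) := by
  have hs : ∀ i j, A j i = A i j := fun i j => by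
    have := congrFun (congrFun hA i) j
    simpa [Matrix.transpose_apply] using this
  have h : ∀ i, ∑ j ∈ Finset.univ.filter (fun j => j ≠ i), A i j * (A i j + A j i) =
      2 * (∑ j, A i j ^ 2) - 2 * A i i ^ 2 := by
    intro i
    have h1 : ∑ j ∈ Finset.univ.filter (fun j => j ≠ i), A i j * (A i j + A j i) =
        ∑ j ∈ Finset.univ.filter (fun j => j ≠ i), 2 * A i j ^ 2 :=
      Finset.sum_congr rfl fun j _ => by rw [hs i j]; ring
    rw [h1, ← Finset.mul_sum]
    have h2 := Finset.sum_filter_add_sum_filter_not Finset.univ (fun j => j ≠ i) (fun j => A i j ^ 2)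
    have h3 : ∑ j ∈ Finset.univ.filter (fun j => ¬j ≠ i), A i j ^ 2 = A i i ^ 2 := by
      simp only [not_ne_iff]
      rw [Finset.filter_eq' Finset.univ i, if_pos (Finset.mem_univ i), Finset.sum_singleton]
    linarith
  simp_rw [h]
  rw [Finset.sum_sub_distrib, ← Finset.mul_sum, ← Finset.mul_sum]
  ring

/-- **Hutchinson's single-sample variance for symmetric `A`**:
`2^{−n} Σ_s (zᵀAz − tr A)² = 2(Σ_{i,j} A_ij² − Σ_i A_ii²)` ("This variance is
`2(‖A‖_F² − Σ_j A_jj²)` for the Hutchinson estimator").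
[cite: SaibabaAlexanderianIpsen2017, §2.3; Hutchinson1990] -/
theorem hutchinson_variance_of_symm (A : Matrix ι ι ℝ) (hA : A.IsSymm) :
    ((2 : ℝ) ^ Fintype.card ι)⁻¹ * ∑ s : Finset ι, (sample A s - A.trace) ^ 2 =
      2 * (∑ i, ∑ j, A i j ^ 2 - ∑ i, A i i ^ 2) := by
  rw [hutchinson_variance, offDiag_sum_of_symm A hA]

end Hutchinson

end Literature.Probability.Moments

end
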